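import Literature.Barriers.CriticalPhenomena.LongRangeTrivialityOnZ3InfraredBound
import HarnessLib

/-!
# Uniform local equipartition, part 1: the TREE FACTORISATION of a periodic nearest-neighbour integral

Support file for crux `BirComplexStableXYR` (stmt-HubbardSuperconductivity-14845), line
`log-concave-core-bounded-phase`, stub `stub_uniformEquipartition` (line lead a2).

For a `2π`-periodic measurable `g : ℝ → ℝ` with `0 ≤ g ≤ 1`, a finite index type `ι` with a ROOT and a
PARENT map `par` that strictly lowers a rank function off the root (a rooted spanning tree), the integral
over the cube `[0,2π]^ι` (product Lebesgue measure) of `Π_{a ≠ root} g(θ_a − θ_{par a})` FACTORISES: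

  `ule_tree_integral`:  `∫ Π_{a ≠ root} g(θ_a − θ_{par a}) dθ = 2π · (∫_{[0,2π]} g)^{|ι| − 1}`.

Proof: induction on the maximal rank; the sites of maximal rank are leaves whose parents have lower
rank, so splitting the coordinates (`MeasurableEquiv.piEquivPiSubtypeProd`, measure preserving) and
Fubini integrates them out first, each contributing `∫_{[0,2π]} g(t − θ_{par a}) dt = ∫_{[0,2π]} g` by
periodicity.  This is the "leaf stripping" behind the sharp upper bound `Z(κ) ≤ 2π·(C/√κ)^{|Λ|−1}` for
coercive window models (file `…ULEUpper`).  Jordan's inequality `2u²/π² ≤ 1 − cos u` is taken from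
`Literature.Barriers.CriticalPhenomena.LongRangeIsing.two_mul_sq_div_le_one_sub_cos`; the finiteness of
Lebesgue measure on `[0,2π]` is Mathlib's instance `Real.isFiniteMeasure_restrict_Icc`. [folklore]
-/

noncomputable section

namespace Summit.HubbardSuperconductivity.HubbardSuperconductivity.Theorems

open MeasureTheory Set

section TreeIntegral


/-- Total mass of the cube `[0,2π]^ι` under the product measure is `(2π)^{|ι|}`; in particular the
integral of the constant `1`. [folklore] -/
theorem ule_integral_one_pi (ι : Type*) [Fintype ι] :
    ∫ _θ : ι → ℝ, (1 : ℝ) ∂(Measure.pi fun _ : ι => volume.restrict (Icc (0:ℝ) (2 * Real.pi))) =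
      (2 * Real.pi) ^ Fintype.card ι := by
  rw [integral_const, smul_eq_mul, mul_one]
  simp only [measureReal_def, Measure.pi_univ, Measure.restrict_apply_univ, Real.volume_Icc, sub_zero,
    Finset.prod_const, Finset.card_univ]
  rw [ENNReal.toReal_pow, ENNReal.toReal_ofReal (by positivity)]

/-- Shift invariance of the period integral: `∫_{[0,2π]} g(t − c) dt = ∫_{[0,2π]} g` for `2π`-periodic `g`.
[folklore] -/
theorem ule_setIntegral_Icc_comp_sub_of_periodic (g : ℝ → ℝ) (hper : Function.Periodic g (2 * Real.pi))
    (c : ℝ) :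
    ∫ t in Icc (0:ℝ) (2 * Real.pi), g (t - c) = ∫ t in Icc (0:ℝ) (2 * Real.pi), g t := by
  have h2π : (0:ℝ) ≤ 2 * Real.pi := by positivity
  rw [integral_Icc_eq_integral_Ioc, ← intervalIntegral.integral_of_le h2π,
    integral_Icc_eq_integral_Ioc, ← intervalIntegral.integral_of_le h2π,
    intervalIntegral.integral_comp_sub_right (fun t => g t) c]
  have := hper.intervalIntegral_add_eq (0 - c) 0
  simp only [zero_add] at this
  rw [show (2 * Real.pi - c) = (0 - c) + 2 * Real.pi by ring]
  exact this

/-- **Tree factorisation (rank-induction form).**  See `ule_tree_integral`. [folklore] -/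
theorem ule_tree_integral_aux (g : ℝ → ℝ) (hmeas : Measurable g) (hper : Function.Periodic g (2 * Real.pi))
    (hnn : ∀ x, 0 ≤ g x) (hle : ∀ x, g x ≤ 1) (n : ℕ) :
    ∀ {ι : Type} [Fintype ι] [DecidableEq ι] (root : ι) (par : ι → ι) (rk : ι → ℕ),
      (∀ a, a ≠ root → rk (par a) < rk a) → rk root = 0 → (∀ a, rk a ≤ n) →
      ∫ θ : ι → ℝ, (∏ a ∈ Finset.univ.erase root, g (θ a - θ (par a)))
          ∂(Measure.pi fun _ : ι => volume.restrict (Icc (0:ℝ) (2 * Real.pi))) =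
        (2 * Real.pi) * (∫ t in Icc (0:ℝ) (2 * Real.pi), g t) ^ (Fintype.card ι - 1) := by
  induction n with
  | zero =>
    intro ι _ _ root par rk hpar hroot hle0
    -- every site is the root
    have hall : ∀ a : ι, a = root := by
      intro a
      by_contra h
      have := hpar a h
      have h1 := hle0 a
      omega
    have hcard : Fintype.card ι = 1 := Fintype.card_eq_one_iff.mpr ⟨root, hall⟩
    have hempty : Finset.univ.erase root = (∅ : Finset ι) := by
      ext a; simp [hall a]
    simp only [hempty, Finset.prod_empty]
    rw [ule_integral_one_pi, hcard]
    simp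
  | succ n ih =>
    intro ι _ _ root par rk hpar hroot hle1
    by_cases htop : ∃ a, rk a = n + 1
    swap
    · -- no site of rank n+1: ranks ≤ n
      push Not at htop
      exact ih root par rk hpar hroot fun a => by have := hle1 a; have := htop a; omega
    -- split off the sites of maximal rank
    set p : ι → Prop := fun a => rk a = n + 1 with hp
    haveI : DecidablePred p := fun a => by simp only [hp]; infer_instance
    have hparT : ∀ a, p a → ¬ p (par a) := by
      intro a ha
      have hne : a ≠ root := by intro h; subst h; simp [hp, hroot] at ha
      have := hpar a hne
      simp only [hp] at ha ⊢; omega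
    have hrootS : ¬ p root := by simp [hp, hroot]
    -- parent map and data on the lower part `S = {¬ p}`
    let S := {b : ι // ¬ p b}
    let T := {a : ι // p a}
    let root' : S := ⟨root, hrootS⟩
    let par' : S → S := fun b => if h : p (par b.1) then root' else ⟨par b.1, h⟩
    have hpar'_val : ∀ b : S, b ≠ root' → (par' b).1 = par b.1 := by
      intro b hb
      have hne : b.1 ≠ root := fun h => hb (Subtype.ext h)
      have hlt := hpar b.1 hne
      have hb2 := b.2
      have : ¬ p (par b.1) := by
        simp only [hp] at hb2 ⊢
        have := hle1 b.1; omega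
      simp [par', this]
    have hpar' : ∀ b : S, b ≠ root' → rk (par' b).1 < rk b.1 := by
      intro b hb
      rw [hpar'_val b hb]
      exact hpar b.1 fun h => hb (Subtype.ext h)
    have hleS : ∀ b : S, rk b.1 ≤ n := by
      intro b; have := hle1 b.1; have hb := b.2; simp only [hp] at hb; omega
    have IH := ih root' par' (fun b => rk b.1) hpar' hroot hleS
    -- the factor measure, the split and measure preservation
    set ν : Measure ℝ := volume.restrict (Icc (0:ℝ) (2 * Real.pi)) with hν
    have hmp := measurePreserving_piEquivPiSubtypeProd (fun _ : ι => ν) p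
    set e := MeasurableEquiv.piEquivPiSubtypeProd (fun _ : ι => ℝ) p with he
    -- the two pieces of the integrand after the split
    set I : ℝ := ∫ t in Icc (0:ℝ) (2 * Real.pi), g t with hI
    let G : (T → ℝ) → (S → ℝ) → ℝ := fun x y => ∏ a : T, g (x a - y ⟨par a.1, hparT a.1 a.2⟩)
    let H : (S → ℝ) → ℝ := fun y => ∏ b ∈ (Finset.univ : Finset S).erase root', g (y b - y (par' b))
    have hsplit : ∀ z : (T → ℝ) × (S → ℝ),
        (∏ a ∈ Finset.univ.erase root, g ((e.symm z) a - (e.symm z) (par a))) = G z.1 z.2 * H z.2 := by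
      intro z
      have hval : ∀ a : ι, (e.symm z) a = if h : p a then z.1 ⟨a, h⟩ else z.2 ⟨a, h⟩ := fun a => rfl
      rw [← Finset.prod_filter_mul_prod_filter_not (s := Finset.univ.erase root) (p := p)]
      congr 1
      · -- the maximal-rank sites
        rw [Finset.prod_subtype (p := p) (Finset.filter p (Finset.univ.erase root)) (fun a => ?_)]
        · refine Finset.prod_congr rfl fun a _ => ?_
          have h1 : (e.symm z) a.1 = z.1 a := by rw [hval, dif_pos a.2]
          have h2 : (e.symm z) (par a.1) = z.2 ⟨par a.1, hparT a.1 a.2⟩ := by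
            rw [hval, dif_neg (hparT a.1 a.2)]
          rw [h1, h2]
        · simp only [Finset.mem_filter, Finset.mem_erase, Finset.mem_univ, and_true, ne_eq,
            and_iff_right_iff_imp]
          intro ha h; subst h; exact hrootS ha
      · -- the lower sites, re-indexed by the subtype `S`
        refine Finset.prod_bij' (fun (a : ι) (ha : a ∈ Finset.filter (fun a => ¬ p a) (Finset.univ.erase root)) =>
            (⟨a, (Finset.mem_filter.1 ha).2⟩ : S)) (fun (b : S) _ => b.1) ?_ ?_ ?_ ?_ ?_
        · intro a ha
          simp only [Finset.mem_filter, Finset.mem_erase, Finset.mem_univ, and_true] at ha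
          simp only [Finset.mem_erase, Finset.mem_univ, and_true, ne_eq]
          intro h; exact ha.1 (congrArg Subtype.val h)
        · intro b hb
          simp only [Finset.mem_erase, Finset.mem_univ, and_true, ne_eq] at hb
          simp only [Finset.mem_filter, Finset.mem_erase, Finset.mem_univ, and_true]
          exact ⟨fun h => hb (Subtype.ext h), b.2⟩
        · intro a ha; rfl
        · intro b hb; rfl
        · intro a ha
          simp only [Finset.mem_filter, Finset.mem_erase, Finset.mem_univ, and_true] at ha
          have hb : (⟨a, ha.2⟩ : S) ≠ root' := fun h => ha.1 (congrArg Subtype.val h)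
          have h1 : (e.symm z) a = z.2 ⟨a, ha.2⟩ := by rw [hval, dif_neg ha.2]
          have hpv := hpar'_val ⟨a, ha.2⟩ hb
          have hnp : ¬ p (par a) := by rw [← hpv]; exact (par' ⟨a, ha.2⟩).2
          have h2 : (e.symm z) (par a) = z.2 (par' ⟨a, ha.2⟩) := by
            rw [hval, dif_neg hnp]
            have : (⟨par a, hnp⟩ : S) = par' ⟨a, ha.2⟩ := Subtype.ext hpv.symm
            rw [this]
          rw [h1, h2]
    -- measurability and boundedness of the two pieces
    have hGmeas : Measurable fun z : (T → ℝ) × (S → ℝ) => G z.1 z.2 := by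
      refine Finset.measurable_prod _ fun a _ => ?_
      exact hmeas.comp (((measurable_pi_apply a).comp measurable_fst).sub
        ((measurable_pi_apply _).comp measurable_snd))
    have hHmeas : Measurable fun y : S → ℝ => H y := by
      refine Finset.measurable_prod _ fun b _ => ?_
      exact hmeas.comp ((measurable_pi_apply b).sub (measurable_pi_apply _))
    have hG01 : ∀ x y, 0 ≤ G x y ∧ G x y ≤ 1 := fun x y =>
      ⟨Finset.prod_nonneg fun a _ => hnn _, Finset.prod_le_one (fun a _ => hnn _) fun a _ => hle _⟩
    have hH01 : ∀ y, 0 ≤ H y ∧ H y ≤ 1 := fun y =>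
      ⟨Finset.prod_nonneg fun a _ => hnn _, Finset.prod_le_one (fun a _ => hnn _) fun a _ => hle _⟩
    haveI : IsFiniteMeasure ν := by rw [hν]; infer_instance
    have hint : Integrable (fun z : (T → ℝ) × (S → ℝ) => G z.1 z.2 * H z.2)
        ((Measure.pi fun _ : T => ν).prod (Measure.pi fun _ : S => ν)) := by
      refine (integrable_const (1:ℝ)).mono' (hGmeas.mul (hHmeas.comp measurable_snd)).aestronglyMeasurable
        (ae_of_all _ fun z => ?_)
      rw [Real.norm_eq_abs, abs_mul, abs_of_nonneg (hG01 z.1 z.2).1, abs_of_nonneg (hH01 z.2).1]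
      calc G z.1 z.2 * H z.2 ≤ 1 * 1 :=
            mul_le_mul (hG01 z.1 z.2).2 (hH01 z.2).2 (hH01 z.2).1 zero_le_one
        _ = 1 := by ring
    -- move the integral through the split
    have hms := hmp.symm e
    rw [← hms.integral_comp']
    have hfun : (fun z : (T → ℝ) × (S → ℝ) =>
        ∏ a ∈ Finset.univ.erase root, g ((e.symm z) a - (e.symm z) (par a))) =
        fun z => G z.1 z.2 * H z.2 := funext hsplit
    rw [hfun, integral_prod_symm _ hint]
    -- the inner integral over the leaves
    have hinner : ∀ y : S → ℝ, ∫ x, G x y * H y ∂(Measure.pi fun _ : T => ν) = I ^ Fintype.card T * H y := by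
      intro y
      rw [integral_mul_const]
      congr 1
      have := integral_fintype_prod_eq_prod (𝕜 := ℝ) (μ := fun _ : T => ν)
        (fun (a : T) (t : ℝ) => g (t - y ⟨par a.1, hparT a.1 a.2⟩))
      rw [this]
      have hfac : ∀ a : T, ∫ t, g (t - y ⟨par a.1, hparT a.1 a.2⟩) ∂ν = I := by
        intro a
        rw [hν, hI]
        exact ule_setIntegral_Icc_comp_sub_of_periodic g hper _
      simp only [hfac, Finset.prod_const, Finset.card_univ]
    simp_rw [hinner]
    rw [integral_const_mul]
    have hIH : ∫ y, H y ∂(Measure.pi fun _ : S => ν) = 2 * Real.pi * I ^ (Fintype.card S - 1) := by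
      rw [hν, hI]
      exact IH
    rw [hIH]
    -- cardinal bookkeeping
    have hcardS : Fintype.card S = Fintype.card ι - Fintype.card T := Fintype.card_subtype_compl _
    have hTle : Fintype.card T ≤ Fintype.card ι := Fintype.card_subtype_le _
    have hSpos : 0 < Fintype.card S := Fintype.card_pos_iff.mpr ⟨root'⟩
    have hexp : Fintype.card T + (Fintype.card S - 1) = Fintype.card ι - 1 := by omega
    rw [← hexp, pow_add]
    ring

/-- **Tree factorisation.**  For a `2π`-periodic measurable `g` with `0 ≤ g ≤ 1` and a rooted parent
structure with a strictly decreasing rank, the cube integral of `Π_{a ≠ root} g(θ_a − θ_{par a})` equals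
`2π·(∫_{[0,2π]} g)^{|ι|−1}`. [folklore] -/
theorem ule_tree_integral :
    ∀ (g : ℝ → ℝ), Measurable g → Function.Periodic g (2 * Real.pi) → (∀ x, 0 ≤ g x) → (∀ x, g x ≤ 1) → ∀ {ι : Type} [Fintype ι] [DecidableEq ι] (root : ι) (par : ι → ι) (rk : ι → ℕ), (∀ a, a ≠ root → rk (par a) < rk a) → rk root = 0 → ∫ θ : ι → ℝ, (∏ a ∈ Finset.univ.erase root, g (θ a - θ (par a))) ∂(Measure.pi fun _ : ι => volume.restrict (Icc (0:ℝ) (2 * Real.pi))) = (2 * Real.pi) * (∫ t in Icc (0:ℝ) (2 * Real.pi), g t) ^ (Fintype.card ι - 1) :=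
  fun g hmeas hper hnn hle _ _ _ root par rk hpar hroot =>
    ule_tree_integral_aux g hmeas hper hnn hle (Finset.univ.sup rk) root par rk hpar hroot
      fun a => Finset.le_sup (Finset.mem_univ a)

end TreeIntegral

/-! ### The one-dimensional factor `∫_{[0,2π]} e^{-κ(1 - cos t)} dt ≤ π^{3/2} (2κ)^{-1/2}` -/

section Bessel

/-- **The one-bond factor is `O(κ^{-1/2})`.**  For `κ > 0`,
`∫_{[0,2π]} exp(-κ(1 - cos t)) dt ≤ π^{3/2}·(2κ)^{-1/2}` (written as `Real.sqrt (Real.pi ^ 3 / (2 * κ))`):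
shift to `[-π, π]` by periodicity, compare with the Gaussian `exp(-(2κ/π²)u²)` and integrate over `ℝ`.
[folklore] -/
theorem ule_bondIntegral_le {κ : ℝ} (hκ : 0 < κ) :
    ∫ t in Icc (0:ℝ) (2 * Real.pi), Real.exp (-(κ * (1 - Real.cos t))) ≤
      Real.sqrt (Real.pi ^ 3 / (2 * κ)) := by
  have hπ := Real.pi_pos
  set f : ℝ → ℝ := fun t => Real.exp (-(κ * (1 - Real.cos t))) with hf
  have hfper : Function.Periodic f (2 * Real.pi) := fun t => by simp [hf, Real.cos_add_two_pi]
  have hfcont : Continuous f := by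
    have : Continuous fun t => -(κ * (1 - Real.cos t)) := by fun_prop
    exact Real.continuous_exp.comp this
  -- shift the window to `[-π, π]`
  have hshift : ∫ t in Icc (0:ℝ) (2 * Real.pi), f t = ∫ t in (-Real.pi)..Real.pi, f t := by
    rw [integral_Icc_eq_integral_Ioc, ← intervalIntegral.integral_of_le (by positivity)]
    have := hfper.intervalIntegral_add_eq 0 (-Real.pi)
    rw [zero_add, show -Real.pi + 2 * Real.pi = Real.pi by ring] at this
    exact this
  rw [hshift]
  -- pointwise Gaussian domination on `[-π, π]`
  set b : ℝ := 2 * κ / Real.pi ^ 2 with hb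
  have hbpos : 0 < b := by positivity
  have hdom : ∀ t ∈ Icc (-Real.pi) Real.pi, f t ≤ Real.exp (-b * t ^ 2) := by
    intro t ht
    have habs : |t| ≤ Real.pi := abs_le.mpr ⟨ht.1, ht.2⟩
    have hj := Literature.Barriers.CriticalPhenomena.LongRangeIsing.two_mul_sq_div_le_one_sub_cos habs
    simp only [hf]
    apply Real.exp_le_exp.mpr
    have : b * t ^ 2 = κ * (2 * t ^ 2 / Real.pi ^ 2) := by rw [hb]; field_simp
    rw [neg_mul, this]
    exact neg_le_neg (mul_le_mul_of_nonneg_left hj hκ.le)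
  have hgi : Integrable fun t : ℝ => Real.exp (-b * t ^ 2) := integrable_exp_neg_mul_sq hbpos
  calc ∫ t in (-Real.pi)..Real.pi, f t
      ≤ ∫ t in (-Real.pi)..Real.pi, Real.exp (-b * t ^ 2) := by
        refine intervalIntegral.integral_mono_on (by linarith) ?_ ?_ hdom
        · exact hfcont.intervalIntegrable _ _
        · exact hgi.intervalIntegrable
    _ ≤ ∫ t, Real.exp (-b * t ^ 2) := by
        rw [intervalIntegral.integral_of_le (by linarith)]
        exact setIntegral_le_integral hgi (ae_of_all _ fun t => (Real.exp_pos _).le)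
    _ = Real.sqrt (Real.pi / b) := integral_gaussian b
    _ = Real.sqrt (Real.pi ^ 3 / (2 * κ)) := by
        congr 1
        rw [hb]
        field_simp

end Bessel

end Summit.HubbardSuperconductivity.HubbardSuperconductivity.Theorems

end
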